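import Summits.Ventures.CertifiedManyBodySolver.Downfold.PinnedPairTPrimeOfQuotChainKernelCertsWide
import Summits.Ventures.CertifiedManyBodySolver.Downfold.TPrimePinnedPairRowKernelBox
import Summits.Ventures.CertifiedManyBodySolver.Downfold.BoxesLa214V115M2cPairRowCloser
import HarnessLib

/-!
# PINNED `t′`-PAIR nodes‴ (WN shapes) ON THE BOX GEOMETRY OF RECORD: `TPrimePinnedPair{Family,}RowWN.of_quotAdjChainNearKernelCerts_box` — the wide
# Near/quotAdj WN pair consumers (`Downfold/PinnedPairTPrimeOfQuotChainKernelCertsWide.lean` §1, p679358) with EVERY table / letter / window hypothesis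
# DISCHARGED generically in `(r, R, vmax)` on hubbard-obs-p2's `BoxGeom.boxQuot r R vmax` (`Rows/CorrWindowBoxGeometry.lean`, p677965), and the M2(c) leaf
# closer in box form

Venture CertifiedManyBodySolver; cell `hubbard-obs` / D-0154 (1)(C) COVERAGE La₂CuO₄; seat `hubbard-cov-la214-box-2` (g4), WN-twin desk. The T-shape box edition
(`SquareTTPrimePinnedPairRowT.of_quotAdjChainNearKernelCertsG_box`, `Downfold/TPrimePinnedPairRowKernelBox.lean`) and its §1 window facts / §2 box dictionaries
(`thicken01_subset_boxW`, `thicken_boxW_subset_boxW`, `boxD_orb_boxIx_zero`, `termOp_boxD_{ham,energy,fsum}TermsIdx{,_cast}`, `termOp_boxD_hamTermsBox`) are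
hubbard-cov-la214-unc-2's (captain hubbard-cov-la214-plan-1 GO, hubbard-obs STATUS 2026-08-28T23:59:29Z) and are IMPORTED BY NAME; the box geometry
(`Rows/CorrWindowBoxGeometry.lean`) and the window facts `boxW_eq_box` / `box_subset_boxW` + the kernel-cheap Hamiltonian word `hamTermsBox`
(`Rows/CorrWindowBoxHamiltonian.lean`, p680316) are hubbard-obs-p2's. THIS file = the WN / objective-family twins and the M2(c) «LSCO x = 1/8» leaf closer on that geometry.

WHY: the wide WN pair consumer of the closer-of-record input shape asks the instance for sixteen geometry facts (`h7 hΛ h8 h0 hz hxs hix hxsβ hcovβ hd hdx hdΛ hf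
hsp hokV ho`). On the exporter's geometry of record — outer table `boxW R`, inner window `boxW r`, licensed shifts `‖v‖∞ ≤ vmax`, tables `BoxGeom.boxQuot r R vmax`,
letters `BoxGeom.boxD R` / `boxD r`, push `boxPush r R`, origin letters `orb (boxIx R 0) σ`, spins read syntactically — every one of them is a theorem in
`(r, R, vmax)` under `7 ≤ R`, `r + 1 ≤ R`, `r + vmax ≤ R`. So a WN instance (M2(c) `Po` / `Oi` pairs; the NdNiO₂ M21/M22 pinned pairs are the same shapes) supplies
`(r R vmax)` with three `norm_num` inequalities, the station `(U, n₀, sA, sB)`, `Bkey`, the objective family `X` (or the constant word `X₀`), ONE shared `EB`,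
and per vertex ONLY certificate data.

* §1 `TPrimePinnedPairFamilyRowWN.of_quotAdjChainNearKernelCerts_box` / `TPrimePinnedPairRowWN.of_quotAdjChainNearKernelCerts_box` — per vertex: dictionaries
  `TH hH TE hE` (the box dictionaries `termOp_boxD_hamTermsIdx` / `termOp_boxD_energyTermsIdx`, or any kernel-cheaper word with the same semantics), the objective
  `TX` with `hX : termOp (boxD R) TX = Γ(incl)(X s_v)` (own f-sum word: `termOp_boxD_fsumTermsIdx`; constant word: `termOp_boxD_fsumTermsIdx_cast`), rows
  `μ ν κ cap κ' fl`, ABSTRACT Gram slices `TGs` (`termOp (boxD R) TGs.flatten = gramForm Λm O`, `Λm ⪰ 0`), `CW hcw AV`, eom-near `masks` with the decidable far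
  check `hfar : eomFarOK TH (boxPush r R) EB masks = true`, the `stepEQA` chain `ns M Cs hC0 Hs hchain` over
  `residTGslicesNear … (boxPush r R) EB masks …` checked against `boxQuot r R vmax`, ONE inequality `hβ`, slope `hsl` ⟹ the WN pair node‴ (family / constant
  word). Proof = `…_wide` (p679358 §1) at `Λ := boxW r ⊆ Λ' := boxW R` with the geometry theorems.
* §2 `La214M2c_StiffnessBoxCeiling_of_quotAdjChainNearKernelPairs_box` — the M2(c) LEAF from a `Po` box pair (vertices `−357/740 ∣ −3/10`, corner word
  `−X₀(−3/10, 29/5)`, ONE `EBo`) + an `Oi` box pair (`−3/10 ∣ −1/5`, own words, ONE `EBi`) on ONE geometry `(r R vmax, Bkey)` + FILE D's decidable row data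
  (`Downfold/BoxesLa214V115M2cKernelPairCloser.lean`, p670727) verbatim, via `La214M2c_StiffnessBoxCeiling_of_pairRows` (p674101).

EFFECT: the M2(c) / WN tier-P instance text shrinks to certificate data + three `norm_num` lines + the decidable row block; no WN instance proves a table fact by
enumeration. Instantiated by NO certificate (no chain of record exists; the M2(c) certificates of record are EXT5-L⁺-class; the tier-P M2(c) instance is unpriced —
interface typing, not a forecast). Edition of record UNCHANGED (`…_cQ` p660755 ⇐ the pair nodes‴ p663521 / p665068; box word 0.4001659, margin 0.0015674).
HONEST FRAMING: Lean plumbing; evaluates nothing, discharges NO node; no number of record / tier / hold / box word / registry row changes; CONTROL / CALIBRATION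
class (wording (xx1)); a ceiling never speaks to the presence of superconductivity or to `ρ_s = 0`; no `T_c` / phase sentence; nothing about La₁.₈₇₅Sr₀.₁₂₅CuO₄
samples; no item (K1/K2 untouched), rung leaf (M2(c) has no route) or summit statement is proved here. Zero compute.

References: X. Han, arXiv:2006.06002, §3 [cite: Han2020Bootstrap, §3]; S. Friedli, Y. Velenik, *Statistical Mechanics of Lattice Systems* (CUP 2017) §3.2
[cite: FriedliVelenikSMLS2017, §3.2]; J. Wang et al., PRX 14 (2024) 031006, §III [cite: WangEtAl2024, §III]; C. Jansson, D. Chaykin, C. Keil, SIAM J. Numer.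
Anal. 46 (2008) 180, §3 [cite: JanssonChaykinKeil2008, §3]; T. Koma, H. Tasaki, J. Stat. Phys. 76 (1994) 745, §1 [cite: KomaTasaki1994, §1].
-/

noncomputable section

namespace Summit.Ventures.CertifiedManyBodySolver.Downfold

open Literature.MathematicalPhysics.QuantumLattice
open Matrix HubbardWave0 Literature.Probability.LatticeModels ThermodynamicLimit Filter Topology
open Literature.MathematicalPhysics.QuantumManyBody.StateRelaxation
open Summit.Ventures.CertifiedQuantumChemistry Summit.Ventures.CertifiedQuantumChemistry.CARPoly
open Summit.Ventures.CertifiedManyBodySolver.CARPolyWindow Summit.Ventures.CertifiedManyBodySolver.CARPolyWindow.BoxGeom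
open Summit.Ventures.CertifiedManyBodySolver.Observables
open scoped BigOperators ComplexOrder

/-! ## §1 THE BOX EDITIONS of the wide Near/quotAdj WN pair consumers -/

section KernelPairBoxWN

/-- **WN-FAMILY PAIR NODE‴ ON THE BOX GEOMETRY OF RECORD** — `D := boxQuot r R vmax`, `Λ := boxW r ⊆ Λ' := boxW R`, letters `boxD R` / `boxD r`, push `boxPush r R`,
origin letters `orb (boxIx R 0) σ`, spins read syntactically; ALL table / letter / window hypotheses of
`TPrimePinnedPairFamilyRowWN.of_quotAdjChainNearKernelCerts_wide` discharged by hubbard-obs-p2's box-geometry theorems under `7 ≤ R`, `r + 1 ≤ R`, `r + vmax ≤ R`.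
Per vertex the instance supplies certificate data only (dictionaries, objective, rows, abstract Gram slices, eom-near masks + far check, the `stepEQA` chain, ONE
inequality, the slope) ⟹ `TPrimePinnedPairFamilyRowWN U sA sB capA capB flA flB βA κA κA' slA βB κB κB' slB n₀ X`.
[cite: Han2020Bootstrap, §3] [cite: WangEtAl2024, §III] [cite: JanssonChaykinKeil2008, §3] -/
theorem TPrimePinnedPairFamilyRowWN.of_quotAdjChainNearKernelCerts_box
    (r R vmax : ℕ) (h7R : 7 ≤ R) (hrR : r + 1 ≤ R) (hvR : r + vmax ≤ R)
    (U : ℚ) (hU : 0 ≤ U) (n₀ sA sB : ℚ) (Bkey : ℕ)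
    -- the objective family and the SHARED eom words (inner letters)
    (X : ℝ → FermionOp (Literature.Probability.LatticeModels.box 2 7)) (EB : List (Terms (Orb (Fin (boxN r)))))
    -- vertex A
    (THA : Terms (Orb (Fin (boxN R))))
    (hHA : termOp (boxD R) THA = (hubbardTTPrimeFermionInteraction 1 (sA : ℝ) (U : ℝ)).localHamiltonian (boxW R))
    (TEA : Terms (Orb (Fin (boxN R))))
    (hEA : termOp (boxD R) TEA =
      fermionEmbed (PolySite.incl (thicken01_subset_boxW (le_trans (by norm_num) h7R)))
        ((hubbardTTPrimeFermionInteraction 1 (sA : ℝ) (U : ℝ)).meanEnergyObs 1))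
    (TXA : Terms (Orb (Fin (boxN R)))) (hXA : termOp (boxD R) TXA = fermionEmbed (PolySite.incl (box_subset_boxW h7R)) (X (sA : ℝ)))
    (μA : Fin 2 → ℚ) (νA κA capA κA' flA : ℚ)
    (TGsA : List (Terms (Orb (Fin (boxN R))))) {mA : Type*} [Fintype mA] [DecidableEq mA] {ΛmA : Matrix mA mA ℂ} (hΛmA : ΛmA.PosSemidef)
    (OA : mA → FermionOp (boxW R)) (hGA : termOp (boxD R) TGsA.flatten = gramForm ΛmA OA)
    (CWA : Terms (Orb (Fin (boxN R)))) (hcwA : ∀ wc ∈ CWA, chargeW wc.1 ≠ 0 ∨ spinChargeW (fun a => (ofLex a).2) wc.1 ≠ 0)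
    (AVA : List (Terms (Orb (Fin (boxN R)))))
    (masksA : List (List Bool)) (hfarA : eomFarOK THA (boxPush r R) EB masksA = true)
    (nsA : List ℕ) (MA : ℕ) (CsA : List SOSDual.EncPoly) (hC0A : CsA.getD 0 [] = []) (HsA : List (List (QHint (boxN r))))
    (hchainA : ChainQAOK (boxQuot r R vmax) Bkey MA CsA
      (groupSlices (residTGslicesNear TXA μA νA (fun σ => orb (boxIx R 0) σ) κA capA κA' flA TEA TGsA THA (boxPush r R) EB masksA
        (fun l : Fin 0 => l.elim0) (fun l : Fin 0 => l.elim0) CWA AVA) nsA) HsA)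
    {βA : ℚ}
    (hβA : haveI := neZero_boxN R; βA ≤ lowerConst (SOSDual.decPoly (boxN R) (CsA.getD MA [])) + (μA 0 + μA 1) * (n₀ / 2 - νA))
    {slA : ℚ} (hslA : slA = (μA 0 + μA 1) / 2)
    -- vertex B
    (THB : Terms (Orb (Fin (boxN R))))
    (hHB : termOp (boxD R) THB = (hubbardTTPrimeFermionInteraction 1 (sB : ℝ) (U : ℝ)).localHamiltonian (boxW R))
    (TEB : Terms (Orb (Fin (boxN R))))
    (hEB : termOp (boxD R) TEB =
      fermionEmbed (PolySite.incl (thicken01_subset_boxW (le_trans (by norm_num) h7R)))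
        ((hubbardTTPrimeFermionInteraction 1 (sB : ℝ) (U : ℝ)).meanEnergyObs 1))
    (TXB : Terms (Orb (Fin (boxN R)))) (hXB : termOp (boxD R) TXB = fermionEmbed (PolySite.incl (box_subset_boxW h7R)) (X (sB : ℝ)))
    (μB : Fin 2 → ℚ) (νB κB capB κB' flB : ℚ)
    (TGsB : List (Terms (Orb (Fin (boxN R))))) {mB : Type*} [Fintype mB] [DecidableEq mB] {ΛmB : Matrix mB mB ℂ} (hΛmB : ΛmB.PosSemidef)
    (OB : mB → FermionOp (boxW R)) (hGB : termOp (boxD R) TGsB.flatten = gramForm ΛmB OB)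
    (CWB : Terms (Orb (Fin (boxN R)))) (hcwB : ∀ wc ∈ CWB, chargeW wc.1 ≠ 0 ∨ spinChargeW (fun a => (ofLex a).2) wc.1 ≠ 0)
    (AVB : List (Terms (Orb (Fin (boxN R)))))
    (masksB : List (List Bool)) (hfarB : eomFarOK THB (boxPush r R) EB masksB = true)
    (nsB : List ℕ) (MB : ℕ) (CsB : List SOSDual.EncPoly) (hC0B : CsB.getD 0 [] = []) (HsB : List (List (QHint (boxN r))))
    (hchainB : ChainQAOK (boxQuot r R vmax) Bkey MB CsB
      (groupSlices (residTGslicesNear TXB μB νB (fun σ => orb (boxIx R 0) σ) κB capB κB' flB TEB TGsB THB (boxPush r R) EB masksB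
        (fun l : Fin 0 => l.elim0) (fun l : Fin 0 => l.elim0) CWB AVB) nsB) HsB)
    {βB : ℚ}
    (hβB : haveI := neZero_boxN R; βB ≤ lowerConst (SOSDual.decPoly (boxN R) (CsB.getD MB [])) + (μB 0 + μB 1) * (n₀ / 2 - νB))
    {slB : ℚ} (hslB : slB = (μB 0 + μB 1) / 2) :
    TPrimePinnedPairFamilyRowWN (U : ℝ) (sA : ℝ) (sB : ℝ) capA capB flA flB βA κA κA' slA βB κB κB' slB n₀ X := by
  haveI : NeZero (boxN R) := neZero_boxN R
  have hrR' : r ≤ R := by omega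
  exact TPrimePinnedPairFamilyRowWN.of_quotAdjChainNearKernelCerts_wide U hU n₀ sA sB (box_subset_boxW h7R) (boxW_mono hrR')
    (thicken_boxW_subset_boxW hrR) (thicken01_subset_boxW (le_trans (by norm_num) h7R)) (zero_mem_boxW R)
    (boxQuot r R vmax) (boxXs_mem R) (fun y hy => boxXs_boxIx R y hy) (boxXs_mem r) (boxQuot_hcovβ r R vmax)
    (boxD R) (boxD_injective R) (boxD_orb R) Bkey (boxD r) (boxQuot_hdΛ r R vmax) (fun b => boxD_boxPush hrR' b)
    (fun a => (ofLex a).2) (boxD_spin R) (fun γc v hok j => box_hokV hvR γc v hok j) (fun σ => orb (boxIx R 0) σ) (boxD_orb_boxIx_zero R) X EB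
    THA hHA TEA hEA TXA hXA μA νA κA capA κA' flA TGsA hΛmA OA hGA CWA hcwA AVA masksA hfarA nsA MA CsA hC0A HsA hchainA hβA hslA
    THB hHB TEB hEB TXB hXB μB νB κB capB κB' flB TGsB hΛmB OB hGB CWB hcwB AVB masksB hfarB nsB MB CsB hC0B HsB hchainB hβB hslB

/-- **CONSTANT-OBJECTIVE WN PAIR NODE‴ ON THE BOX GEOMETRY OF RECORD** (`TPrimePinnedPairRowWN … X₀`; e.g. the M2(c) `Po` pair with the corner word `−X₀(−3/10, 29/5)`,
objective slot discharged by `termOp_boxD_fsumTermsIdx_cast`), via `TPrimePinnedPairRowWN_iff_family`. [cite: Han2020Bootstrap, §3] [cite: WangEtAl2024, §III] -/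
theorem TPrimePinnedPairRowWN.of_quotAdjChainNearKernelCerts_box
    (r R vmax : ℕ) (h7R : 7 ≤ R) (hrR : r + 1 ≤ R) (hvR : r + vmax ≤ R)
    (U : ℚ) (hU : 0 ≤ U) (n₀ sA sB : ℚ) (Bkey : ℕ)
    (X₀ : FermionOp (Literature.Probability.LatticeModels.box 2 7)) (EB : List (Terms (Orb (Fin (boxN r)))))
    -- vertex A
    (THA : Terms (Orb (Fin (boxN R))))
    (hHA : termOp (boxD R) THA = (hubbardTTPrimeFermionInteraction 1 (sA : ℝ) (U : ℝ)).localHamiltonian (boxW R))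
    (TEA : Terms (Orb (Fin (boxN R))))
    (hEA : termOp (boxD R) TEA =
      fermionEmbed (PolySite.incl (thicken01_subset_boxW (le_trans (by norm_num) h7R)))
        ((hubbardTTPrimeFermionInteraction 1 (sA : ℝ) (U : ℝ)).meanEnergyObs 1))
    (TXA : Terms (Orb (Fin (boxN R)))) (hXA : termOp (boxD R) TXA = fermionEmbed (PolySite.incl (box_subset_boxW h7R)) X₀)
    (μA : Fin 2 → ℚ) (νA κA capA κA' flA : ℚ)
    (TGsA : List (Terms (Orb (Fin (boxN R))))) {mA : Type*} [Fintype mA] [DecidableEq mA] {ΛmA : Matrix mA mA ℂ} (hΛmA : ΛmA.PosSemidef)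
    (OA : mA → FermionOp (boxW R)) (hGA : termOp (boxD R) TGsA.flatten = gramForm ΛmA OA)
    (CWA : Terms (Orb (Fin (boxN R)))) (hcwA : ∀ wc ∈ CWA, chargeW wc.1 ≠ 0 ∨ spinChargeW (fun a => (ofLex a).2) wc.1 ≠ 0)
    (AVA : List (Terms (Orb (Fin (boxN R)))))
    (masksA : List (List Bool)) (hfarA : eomFarOK THA (boxPush r R) EB masksA = true)
    (nsA : List ℕ) (MA : ℕ) (CsA : List SOSDual.EncPoly) (hC0A : CsA.getD 0 [] = []) (HsA : List (List (QHint (boxN r))))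
    (hchainA : ChainQAOK (boxQuot r R vmax) Bkey MA CsA
      (groupSlices (residTGslicesNear TXA μA νA (fun σ => orb (boxIx R 0) σ) κA capA κA' flA TEA TGsA THA (boxPush r R) EB masksA
        (fun l : Fin 0 => l.elim0) (fun l : Fin 0 => l.elim0) CWA AVA) nsA) HsA)
    {βA : ℚ}
    (hβA : haveI := neZero_boxN R; βA ≤ lowerConst (SOSDual.decPoly (boxN R) (CsA.getD MA [])) + (μA 0 + μA 1) * (n₀ / 2 - νA))
    {slA : ℚ} (hslA : slA = (μA 0 + μA 1) / 2)
    -- vertex B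
    (THB : Terms (Orb (Fin (boxN R))))
    (hHB : termOp (boxD R) THB = (hubbardTTPrimeFermionInteraction 1 (sB : ℝ) (U : ℝ)).localHamiltonian (boxW R))
    (TEB : Terms (Orb (Fin (boxN R))))
    (hEB : termOp (boxD R) TEB =
      fermionEmbed (PolySite.incl (thicken01_subset_boxW (le_trans (by norm_num) h7R)))
        ((hubbardTTPrimeFermionInteraction 1 (sB : ℝ) (U : ℝ)).meanEnergyObs 1))
    (TXB : Terms (Orb (Fin (boxN R)))) (hXB : termOp (boxD R) TXB = fermionEmbed (PolySite.incl (box_subset_boxW h7R)) X₀)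
    (μB : Fin 2 → ℚ) (νB κB capB κB' flB : ℚ)
    (TGsB : List (Terms (Orb (Fin (boxN R))))) {mB : Type*} [Fintype mB] [DecidableEq mB] {ΛmB : Matrix mB mB ℂ} (hΛmB : ΛmB.PosSemidef)
    (OB : mB → FermionOp (boxW R)) (hGB : termOp (boxD R) TGsB.flatten = gramForm ΛmB OB)
    (CWB : Terms (Orb (Fin (boxN R)))) (hcwB : ∀ wc ∈ CWB, chargeW wc.1 ≠ 0 ∨ spinChargeW (fun a => (ofLex a).2) wc.1 ≠ 0)
    (AVB : List (Terms (Orb (Fin (boxN R)))))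
    (masksB : List (List Bool)) (hfarB : eomFarOK THB (boxPush r R) EB masksB = true)
    (nsB : List ℕ) (MB : ℕ) (CsB : List SOSDual.EncPoly) (hC0B : CsB.getD 0 [] = []) (HsB : List (List (QHint (boxN r))))
    (hchainB : ChainQAOK (boxQuot r R vmax) Bkey MB CsB
      (groupSlices (residTGslicesNear TXB μB νB (fun σ => orb (boxIx R 0) σ) κB capB κB' flB TEB TGsB THB (boxPush r R) EB masksB
        (fun l : Fin 0 => l.elim0) (fun l : Fin 0 => l.elim0) CWB AVB) nsB) HsB)
    {βB : ℚ}
    (hβB : haveI := neZero_boxN R; βB ≤ lowerConst (SOSDual.decPoly (boxN R) (CsB.getD MB [])) + (μB 0 + μB 1) * (n₀ / 2 - νB))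
    {slB : ℚ} (hslB : slB = (μB 0 + μB 1) / 2) :
    TPrimePinnedPairRowWN (U : ℝ) (sA : ℝ) (sB : ℝ) capA capB flA flB βA κA κA' slA βB κB κB' slB n₀ X₀ :=
  (TPrimePinnedPairRowWN_iff_family).2
    (TPrimePinnedPairFamilyRowWN.of_quotAdjChainNearKernelCerts_box r R vmax h7R hrR hvR U hU n₀ sA sB Bkey (fun _ => X₀) EB
      THA hHA TEA hEA TXA hXA μA νA κA capA κA' flA TGsA hΛmA OA hGA CWA hcwA AVA masksA hfarA nsA MA CsA hC0A HsA hchainA hβA hslA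
      THB hHB TEB hEB TXB hXB μB νB κB capB κB' flB TGsB hΛmB OB hGB CWB hcwB AVB masksB hfarB nsB MB CsB hC0B HsB hchainB hβB hslB)

end KernelPairBoxWN

/-! ## §2 THE M2(c) LEAF FROM TWO BOX PAIRS (`Po`, `Oi`) + FILE D's DECIDABLE ROW DATA -/

section M2cBoxCloser

/-- **`La214M2c_StiffnessBoxCeiling` ⇐ TWO `stepEQA` BOX PAIRS + DECIDABLE ROW DATA** — ONE geometry `(r R vmax)` (`7 ≤ R`, `r + 1 ≤ R`, `r + vmax ≤ R`) and ONE `Bkey`;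
the `Po` pair (vertex `oA` at `t′ = −357/740`, `oB` at `−3/10`; corner word `−X₀(−3/10, 29/5)` in both objective slots; ONE `EBo`) and the `Oi` pair (`iA` at `−3/10`,
`iB` at `−1/5`; own words `−X₀(s_v, 29/5)`; ONE `EBi`), each vertex = certificate data as in §1 at the station `(U, n₀) = (29/5, 7/8)`; then FILE D's row data
verbatim (`κ ≥ 0` ×8; kernel cross constants; `Po` INTERIOR kind; `Oi` VERTEX kind in the symmetric form; eight end prices `≤ c`; `4001658052/10¹⁰ ≤ c ≤ 4017332/10⁷`)
⟹ the leaf, via `La214M2c_StiffnessBoxCeiling_of_pairRows`. [cite: WangEtAl2024, §III] [cite: Han2020Bootstrap, §3] [cite: KomaTasaki1994, §1] -/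
theorem La214M2c_StiffnessBoxCeiling_of_quotAdjChainNearKernelPairs_box
    (r R vmax : ℕ) (h7R : 7 ≤ R) (hrR : r + 1 ≤ R) (hvR : r + vmax ≤ R) (Bkey : ℕ)
    -- ===== the `Po` pair: shared eom words =====
    (EBo : List (Terms (Orb (Fin (boxN r)))))
    -- vertex oA (t′ = −357/740)
    (THoA : Terms (Orb (Fin (boxN R))))
    (hHoA : termOp (boxD R) THoA = (hubbardTTPrimeFermionInteraction 1 (((-(357 / 740) : ℚ)) : ℝ) (((29 / 5 : ℚ)) : ℝ)).localHamiltonian (boxW R))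
    (TEoA : Terms (Orb (Fin (boxN R))))
    (hEoA : termOp (boxD R) TEoA =
      fermionEmbed (PolySite.incl (thicken01_subset_boxW (le_trans (by norm_num) h7R)))
        ((hubbardTTPrimeFermionInteraction 1 (((-(357 / 740) : ℚ)) : ℝ) (((29 / 5 : ℚ)) : ℝ)).meanEnergyObs 1))
    (TXoA : Terms (Orb (Fin (boxN R))))
    (hXoA : termOp (boxD R) TXoA = fermionEmbed (PolySite.incl (box_subset_boxW h7R)) (-oddMomentObsTT (-3 / 10) (29 / 5) 0))
    (μoA : Fin 2 → ℚ) (νoA κoA capoA κoA' floA : ℚ)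
    (TGsoA : List (Terms (Orb (Fin (boxN R))))) {moA : Type*} [Fintype moA] [DecidableEq moA] {ΛmoA : Matrix moA moA ℂ} (hΛmoA : ΛmoA.PosSemidef)
    (OoA : moA → FermionOp (boxW R)) (hGoA : termOp (boxD R) TGsoA.flatten = gramForm ΛmoA OoA)
    (CWoA : Terms (Orb (Fin (boxN R)))) (hcwoA : ∀ wc ∈ CWoA, chargeW wc.1 ≠ 0 ∨ spinChargeW (fun a => (ofLex a).2) wc.1 ≠ 0)
    (AVoA : List (Terms (Orb (Fin (boxN R)))))
    (masksoA : List (List Bool)) (hfaroA : eomFarOK THoA (boxPush r R) EBo masksoA = true)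
    (nsoA : List ℕ) (MoA : ℕ) (CsoA : List SOSDual.EncPoly) (hC0oA : CsoA.getD 0 [] = []) (HsoA : List (List (QHint (boxN r))))
    (hchainoA : ChainQAOK (boxQuot r R vmax) Bkey MoA CsoA
      (groupSlices (residTGslicesNear TXoA μoA νoA (fun σ => orb (boxIx R 0) σ) κoA capoA κoA' floA TEoA TGsoA THoA (boxPush r R) EBo masksoA
        (fun l : Fin 0 => l.elim0) (fun l : Fin 0 => l.elim0) CWoA AVoA) nsoA) HsoA)
    {βoA : ℚ}
    (hβoA : haveI := neZero_boxN R; βoA ≤ lowerConst (SOSDual.decPoly (boxN R) (CsoA.getD MoA [])) + (μoA 0 + μoA 1) * ((7 / 8 : ℚ) / 2 - νoA))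
    {sloA : ℚ} (hsloA : sloA = (μoA 0 + μoA 1) / 2)
    -- vertex oB (t′ = −3/10)
    (THoB : Terms (Orb (Fin (boxN R))))
    (hHoB : termOp (boxD R) THoB = (hubbardTTPrimeFermionInteraction 1 (((-3 / 10 : ℚ)) : ℝ) (((29 / 5 : ℚ)) : ℝ)).localHamiltonian (boxW R))
    (TEoB : Terms (Orb (Fin (boxN R))))
    (hEoB : termOp (boxD R) TEoB =
      fermionEmbed (PolySite.incl (thicken01_subset_boxW (le_trans (by norm_num) h7R)))
        ((hubbardTTPrimeFermionInteraction 1 (((-3 / 10 : ℚ)) : ℝ) (((29 / 5 : ℚ)) : ℝ)).meanEnergyObs 1))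
    (TXoB : Terms (Orb (Fin (boxN R))))
    (hXoB : termOp (boxD R) TXoB = fermionEmbed (PolySite.incl (box_subset_boxW h7R)) (-oddMomentObsTT (-3 / 10) (29 / 5) 0))
    (μoB : Fin 2 → ℚ) (νoB κoB capoB κoB' floB : ℚ)
    (TGsoB : List (Terms (Orb (Fin (boxN R))))) {moB : Type*} [Fintype moB] [DecidableEq moB] {ΛmoB : Matrix moB moB ℂ} (hΛmoB : ΛmoB.PosSemidef)
    (OoB : moB → FermionOp (boxW R)) (hGoB : termOp (boxD R) TGsoB.flatten = gramForm ΛmoB OoB)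
    (CWoB : Terms (Orb (Fin (boxN R)))) (hcwoB : ∀ wc ∈ CWoB, chargeW wc.1 ≠ 0 ∨ spinChargeW (fun a => (ofLex a).2) wc.1 ≠ 0)
    (AVoB : List (Terms (Orb (Fin (boxN R)))))
    (masksoB : List (List Bool)) (hfaroB : eomFarOK THoB (boxPush r R) EBo masksoB = true)
    (nsoB : List ℕ) (MoB : ℕ) (CsoB : List SOSDual.EncPoly) (hC0oB : CsoB.getD 0 [] = []) (HsoB : List (List (QHint (boxN r))))
    (hchainoB : ChainQAOK (boxQuot r R vmax) Bkey MoB CsoB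
      (groupSlices (residTGslicesNear TXoB μoB νoB (fun σ => orb (boxIx R 0) σ) κoB capoB κoB' floB TEoB TGsoB THoB (boxPush r R) EBo masksoB
        (fun l : Fin 0 => l.elim0) (fun l : Fin 0 => l.elim0) CWoB AVoB) nsoB) HsoB)
    {βoB : ℚ}
    (hβoB : haveI := neZero_boxN R; βoB ≤ lowerConst (SOSDual.decPoly (boxN R) (CsoB.getD MoB [])) + (μoB 0 + μoB 1) * ((7 / 8 : ℚ) / 2 - νoB))
    {sloB : ℚ} (hsloB : sloB = (μoB 0 + μoB 1) / 2)
    -- ===== the `Oi` pair: shared eom words =====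
    (EBi : List (Terms (Orb (Fin (boxN r)))))
    -- vertex iA (t′ = −3/10)
    (THiA : Terms (Orb (Fin (boxN R))))
    (hHiA : termOp (boxD R) THiA = (hubbardTTPrimeFermionInteraction 1 (((-3 / 10 : ℚ)) : ℝ) (((29 / 5 : ℚ)) : ℝ)).localHamiltonian (boxW R))
    (TEiA : Terms (Orb (Fin (boxN R))))
    (hEiA : termOp (boxD R) TEiA =
      fermionEmbed (PolySite.incl (thicken01_subset_boxW (le_trans (by norm_num) h7R)))
        ((hubbardTTPrimeFermionInteraction 1 (((-3 / 10 : ℚ)) : ℝ) (((29 / 5 : ℚ)) : ℝ)).meanEnergyObs 1))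
    (TXiA : Terms (Orb (Fin (boxN R))))
    (hXiA : termOp (boxD R) TXiA = fermionEmbed (PolySite.incl (box_subset_boxW h7R)) (-oddMomentObsTT (-3 / 10) (29 / 5) 0))
    (μiA : Fin 2 → ℚ) (νiA κiA capiA κiA' fliA : ℚ)
    (TGsiA : List (Terms (Orb (Fin (boxN R))))) {miA : Type*} [Fintype miA] [DecidableEq miA] {ΛmiA : Matrix miA miA ℂ} (hΛmiA : ΛmiA.PosSemidef)
    (OiA : miA → FermionOp (boxW R)) (hGiA : termOp (boxD R) TGsiA.flatten = gramForm ΛmiA OiA)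
    (CWiA : Terms (Orb (Fin (boxN R)))) (hcwiA : ∀ wc ∈ CWiA, chargeW wc.1 ≠ 0 ∨ spinChargeW (fun a => (ofLex a).2) wc.1 ≠ 0)
    (AViA : List (Terms (Orb (Fin (boxN R)))))
    (masksiA : List (List Bool)) (hfariA : eomFarOK THiA (boxPush r R) EBi masksiA = true)
    (nsiA : List ℕ) (MiA : ℕ) (CsiA : List SOSDual.EncPoly) (hC0iA : CsiA.getD 0 [] = []) (HsiA : List (List (QHint (boxN r))))
    (hchainiA : ChainQAOK (boxQuot r R vmax) Bkey MiA CsiA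
      (groupSlices (residTGslicesNear TXiA μiA νiA (fun σ => orb (boxIx R 0) σ) κiA capiA κiA' fliA TEiA TGsiA THiA (boxPush r R) EBi masksiA
        (fun l : Fin 0 => l.elim0) (fun l : Fin 0 => l.elim0) CWiA AViA) nsiA) HsiA)
    {βiA : ℚ}
    (hβiA : haveI := neZero_boxN R; βiA ≤ lowerConst (SOSDual.decPoly (boxN R) (CsiA.getD MiA [])) + (μiA 0 + μiA 1) * ((7 / 8 : ℚ) / 2 - νiA))
    {sliA : ℚ} (hsliA : sliA = (μiA 0 + μiA 1) / 2)
    -- vertex iB (t′ = −1/5)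
    (THiB : Terms (Orb (Fin (boxN R))))
    (hHiB : termOp (boxD R) THiB = (hubbardTTPrimeFermionInteraction 1 (((-1 / 5 : ℚ)) : ℝ) (((29 / 5 : ℚ)) : ℝ)).localHamiltonian (boxW R))
    (TEiB : Terms (Orb (Fin (boxN R))))
    (hEiB : termOp (boxD R) TEiB =
      fermionEmbed (PolySite.incl (thicken01_subset_boxW (le_trans (by norm_num) h7R)))
        ((hubbardTTPrimeFermionInteraction 1 (((-1 / 5 : ℚ)) : ℝ) (((29 / 5 : ℚ)) : ℝ)).meanEnergyObs 1))
    (TXiB : Terms (Orb (Fin (boxN R))))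
    (hXiB : termOp (boxD R) TXiB = fermionEmbed (PolySite.incl (box_subset_boxW h7R)) (-oddMomentObsTT (-1 / 5) (29 / 5) 0))
    (μiB : Fin 2 → ℚ) (νiB κiB capiB κiB' fliB : ℚ)
    (TGsiB : List (Terms (Orb (Fin (boxN R))))) {miB : Type*} [Fintype miB] [DecidableEq miB] {ΛmiB : Matrix miB miB ℂ} (hΛmiB : ΛmiB.PosSemidef)
    (OiB : miB → FermionOp (boxW R)) (hGiB : termOp (boxD R) TGsiB.flatten = gramForm ΛmiB OiB)
    (CWiB : Terms (Orb (Fin (boxN R)))) (hcwiB : ∀ wc ∈ CWiB, chargeW wc.1 ≠ 0 ∨ spinChargeW (fun a => (ofLex a).2) wc.1 ≠ 0)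
    (AViB : List (Terms (Orb (Fin (boxN R)))))
    (masksiB : List (List Bool)) (hfariB : eomFarOK THiB (boxPush r R) EBi masksiB = true)
    (nsiB : List ℕ) (MiB : ℕ) (CsiB : List SOSDual.EncPoly) (hC0iB : CsiB.getD 0 [] = []) (HsiB : List (List (QHint (boxN r))))
    (hchainiB : ChainQAOK (boxQuot r R vmax) Bkey MiB CsiB
      (groupSlices (residTGslicesNear TXiB μiB νiB (fun σ => orb (boxIx R 0) σ) κiB capiB κiB' fliB TEiB TGsiB THiB (boxPush r R) EBi masksiB
        (fun l : Fin 0 => l.elim0) (fun l : Fin 0 => l.elim0) CWiB AViB) nsiB) HsiB)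
    {βiB : ℚ}
    (hβiB : haveI := neZero_boxN R; βiB ≤ lowerConst (SOSDual.decPoly (boxN R) (CsiB.getD MiB [])) + (μiB 0 + μiB 1) * ((7 / 8 : ℚ) / 2 - νiB))
    {sliB : ℚ} (hsliB : sliB = (μiB 0 + μiB 1) / 2)
    -- ===== row data and DECIDABLE side conditions (FILE D verbatim) =====
    (Fo Lo Fi Li c : ℚ)
    (hκoA : 0 ≤ κoA) (hκoA' : 0 ≤ κoA') (hκoB : 0 ≤ κoB) (hκoB' : 0 ≤ κoB')
    (hκiA : 0 ≤ κiA) (hκiA' : 0 ≤ κiA') (hκiB : 0 ≤ κiB) (hκiB' : 0 ≤ κiB')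
    (hLo₁ : (16211390 / 10000000 : ℚ) * (27 / 148) * (κoA - κoA' - (κoB - κoB')) ≤ Lo)
    (hLo₂ : (16211390 / 10000000 : ℚ) * (27 / 148) * -(κoA - κoA' - (κoB - κoB')) ≤ Lo) (hLo0 : 0 < Lo)
    (hFo : Fo ≤ (βoA - κoA * ((-136960406889 / 200000000000 : ℚ) - capoA) - κoA' * (floA - (-3))) -
      (Lo - ((βoB - κoB * ((-136960406889 / 200000000000 : ℚ) - capoB) - κoB' * (floB - (-3))) - (βoA - κoA * ((-136960406889 / 200000000000 : ℚ) - capoA) - κoA' * (floA - (-3))))) ^ 2 / (4 * Lo))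
    (hLi₁ : (16211390 / 10000000 : ℚ) * (1 / 10) * (κiA - κiA' - (κiB - κiB')) ≤ Li)
    (hLi₂ : (16211390 / 10000000 : ℚ) * (1 / 10) * -(κiA - κiA' - (κiB - κiB')) ≤ Li) (hLi0 : 0 ≤ Li)
    (hLi : Li ≤ |(βiB - κiB * ((-2686934003 / 4000000000 : ℚ) - capiB) - κiB' * (fliB - (-3))) - (βiA - κiA * ((-2686934003 / 4000000000 : ℚ) - capiA) - κiA' * (fliA - (-3)))|)
    (hFi : Fi ≤ min (βiA - κiA * ((-2686934003 / 4000000000 : ℚ) - capiA) - κiA' * (fliA - (-3))) (βiB - κiB * ((-2686934003 / 4000000000 : ℚ) - capiB) - κiB' * (fliB - (-3))))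
    (hbar : c ≤ 4017332 / 10000000) (hkin : (4001658052 / 10000000000 : ℚ) ≤ c)
    (pPo : -Fo - sloA * (171 / 200 - 7 / 8) ≤ c ∧ -Fo - sloA * (179 / 200 - 7 / 8) ≤ c ∧
      -Fo - sloB * (171 / 200 - 7 / 8) ≤ c ∧ -Fo - sloB * (179 / 200 - 7 / 8) ≤ c)
    (pOi : -Fi - sliA * (171 / 200 - 7 / 8) ≤ c ∧ -Fi - sliA * (179 / 200 - 7 / 8) ≤ c ∧
      -Fi - sliB * (171 / 200 - 7 / 8) ≤ c ∧ -Fi - sliB * (179 / 200 - 7 / 8) ≤ c) :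
    La214M2c_StiffnessBoxCeiling := by
  -- cast literals
  have eU : (((29 / 5 : ℚ)) : ℝ) = 29 / 5 := by norm_num
  have eo : (((-(357 / 740) : ℚ)) : ℝ) = -(357 / 740) := by norm_num
  have em : (((-3 / 10 : ℚ)) : ℝ) = -3 / 10 := by norm_num
  have ei : (((-1 / 5 : ℚ)) : ℝ) = -1 / 5 := by norm_num
  -- (1) the `Po` box pair ⇒ the constant-objective pair row
  have pairPo := TPrimePinnedPairRowWN.of_quotAdjChainNearKernelCerts_box r R vmax h7R hrR hvR (29 / 5) (by norm_num) (7 / 8) (-(357 / 740)) (-3 / 10) Bkey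
    (-oddMomentObsTT (-3 / 10) (29 / 5) 0) EBo
    THoA hHoA TEoA hEoA TXoA hXoA μoA νoA κoA capoA κoA' floA TGsoA hΛmoA OoA hGoA CWoA hcwoA AVoA masksoA hfaroA nsoA MoA CsoA hC0oA HsoA hchainoA
    hβoA hsloA
    THoB hHoB TEoB hEoB TXoB hXoB μoB νoB κoB capoB κoB' floB TGsoB hΛmoB OoB hGoB CWoB hcwoB AVoB masksoB hfaroB nsoB MoB CsoB hC0oB HsoB hchainoB
    hβoB hsloB
  rw [eU, eo, em] at pairPo
  -- (2) the `Oi` box pair ⇒ the objective-family pair row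
  have hXiA' : termOp (boxD R) TXiA =
      fermionEmbed (PolySite.incl (box_subset_boxW h7R)) ((fun s : ℝ => -oddMomentObsTT s (29 / 5) 0) (((-3 / 10 : ℚ)) : ℝ)) := by
    simp only [em]; exact hXiA
  have hXiB' : termOp (boxD R) TXiB =
      fermionEmbed (PolySite.incl (box_subset_boxW h7R)) ((fun s : ℝ => -oddMomentObsTT s (29 / 5) 0) (((-1 / 5 : ℚ)) : ℝ)) := by
    simp only [ei]; exact hXiB
  have pairOi := TPrimePinnedPairFamilyRowWN.of_quotAdjChainNearKernelCerts_box r R vmax h7R hrR hvR (29 / 5) (by norm_num) (7 / 8) (-3 / 10) (-1 / 5) Bkey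
    (fun s : ℝ => -oddMomentObsTT s (29 / 5) 0) EBi
    THiA hHiA TEiA hEiA TXiA hXiA' μiA νiA κiA capiA κiA' fliA TGsiA hΛmiA OiA hGiA CWiA hcwiA AViA masksiA hfariA nsiA MiA CsiA hC0iA HsiA hchainiA
    hβiA hsliA
    THiB hHiB TEiB hEiB TXiB hXiB' μiB νiB κiB capiB κiB' fliB TGsiB hΛmiB OiB hGiB CWiB hcwiB AViB masksiB hfariB nsiB MiB CsiB hC0iB HsiB hchainiB
    hβiB hsliB
  rw [eU, em, ei] at pairOi
  -- (3) the shape-level closer (p674101)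
  exact La214M2c_StiffnessBoxCeiling_of_pairRows pairPo pairOi Fo Lo Fi Li c hκoA hκoA' hκoB hκoB' hκiA hκiA' hκiB hκiB' hLo₁ hLo₂ hLo0 hFo
    hLi₁ hLi₂ hLi0 hLi hFi hbar hkin pPo pOi

end M2cBoxCloser

end Summit.Ventures.CertifiedManyBodySolver.Downfold

end
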